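import Summits.BirchSwinnertonDyer.BirchSwinnertonDyer.Theorems.GenusKolyvaginAtTwoEquivariantKolyvaginExactAtTwoLemma53Rat
import Summits.BirchSwinnertonDyer.BirchSwinnertonDyer.Theorems.GenusKolyvaginAtTwoGenusPrimitiveSupplyAtTwoTwistingPrimeLocal
import Literature.NumberTheory.GaloisRepresentations.HeckeCharacterProofs
import HarnessLib

/-!
# Route `ByReductionTypeAtTwo`, crux `RankOneAtTwoOffBigImageOddLocal` (stmt-BirchSwinnertonDyer-23716), line
# `refined_kolyvagin_tamagawa_shift_at_two`, stub `stub_sigmaShiftPosDisc` (K3 on {full image, `Δ > 0`}, `σ ≥ 1`):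
# McCALLUM'S LEMMA 5.3 WITH PROP. 2.2 OVER `ℚ_ℓ` AT `p = 2` AT A **REGULAR** KOLYVAGIN PRIME — no sign condition on `Δ`

Lead prover `prover-cruxlead-stmt-BirchSwinnertonDyer-23716-g4` (2026-08-28; `--supports` the crux, closes nothing).  The sibling route's
seat `bsd-line-gk2-p3` proved McCallum's Lemma 5.3 (with Prop. 2.2, over `ℚ_ℓ`, at `p = 2`, NO `2`-adic defect) in
`…GenusKolyvaginAtTwoEquivariantKolyvaginExactAtTwoLemma53Rat.lean` under TWO hypotheses that tie it to the habitat `Δ < 0`: the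
Gross–Kolyvagin prime condition `FrobEqFrobInfty` («`Frob(ℓ) = Frob(∞)` on `ℚ(E[q])`») and `Δ < 0` (so that complex conjugation is a
REGULAR involution of `E[q]`, `E[q] ≅ ℤ/q[c₀]` free of rank one).  Reading that proof shows it uses exactly three things about the
Frobenius `F` at `𝔓 ∣ ℓ`: (R) `F` acts on `E[q]` as an involution MOVING a `2`-torsion point (⟹ `E[q] = ℤP ⊕ ℤ·FP` freely over `ℤ/q`),
(μ) `F` inverts `μ_q`, and the local criterion `…FrobeniusCriterion.pow_zsmul_mem_torsionLocalKer_of_pairing_eq_zero` (generic in `F`).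
On this line's cell `Δ > 0` complex conjugation FIXES `E[2]` pointwise and (R) fails for `Frob(ℓ) = Frob(∞)`; the line's ENGINE
(`…Engine*.lean`, `Engine.exists_regular_kolyvaginPrime_of_heegner`) supplies instead Kolyvagin primes at `2` (`2^M ∣ ℓ + 1`, `2^M ∣ a_ℓ`,
`ℓ` inert in `K`) whose Frobenius is a REGULAR involution `h = c₀·ρ` of `E[2^M]`.  This file proves Lemma 5.3 for THOSE primes:

* `exists_regular_generator_of_smul_twoTorsion_ne` — (R) ⟹ the free `ℤ/q`-basis `P, F·P` of `E[q]` (GK2's `exists_regular_generator_of_Δ_neg`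
  with its first line — the moved `2`-torsion point — turned into the hypothesis; R1 of the line, `cyclicTorsion_of_smul_twoTorsion_ne`, with
  independence for the SAME generator);
* `smul_rootOfUnity_eq_inv_of_isArithFrobAt` — (μ) for ANY arithmetic Frobenius at `𝔓 ∣ ℓ` once `q ∣ ℓ + 1` (`F·ζ = ζ^ℓ = ζ⁻¹`;
  `χ_cyc(Frob_ℓ) = ℓ`, the tree's `smul_eq_pow_residueCard_of_isArithFrobAt_of_pow_eq_one`) — replacing the Weil-pairing argument
  `smul_eq_inv_of_smul_torsion_pow_eq`, which needs `F = c₀` on `E[q]`;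
* `regularFrobAt_transfer` — the regular-Frobenius datum at ONE prime `𝔓₀ ∣ ℓ` (the shape the engine outputs: `∃ v 𝔓 h, …`) moves to EVERY
  `𝔓 ∣ ℓ` (transitivity of `Γ_ℚ` on the primes above `ℓ`, as in `FrobEqFrobInfty.exists_at`);
* **`lemma_5_3_descent_of_reciprocity_rat_two_regular`** — MAIN: `E = W/ℚ` elliptic (ANY sign of `Δ`), `q = 2^M`, `M ≥ 1`, `ℓ` an odd prime
  of good reduction at the place `v` with `q ∣ ℓ + 1`, and a Frobenius at some `𝔓₀ ∣ ℓ` acting on `E[q]` as an involution that moves a point of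
  `E[2]`; `e` alternating left-non-degenerate on `E[q]`; `d, s ∈ H¹(ℚ, E[q])` with `2^a d` NOT Selmer at `v`, `s` Selmer at `v`; IF the
  reciprocity value `e([s, F], [d, σ])` vanishes for every Frobenius `F` at every `𝔓 ∣ v` acting as an involution on `E[q]` and every
  `σ ∈ I_𝔓`, THEN `2^{M−1−a}·s_v = 0` — the printed exponent, no defect.  GK2's theorem is the instance «`F = c₀` on `E[q]`, `Δ < 0`».

This is the first CONSUMER lemma of the regular engine in McCallum §5's global argument (the g2 lead's «(γ) consumers at a REGULAR prime»):
the piece of the `σ ≥ 1`, `Δ > 0` structure theorem (stub `stub_sigmaShiftPosDisc`, and 24883's wall at `σ = 0`) where the sibling's proof used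
`Δ < 0`.  Pure theorems (no definition, no named fact, no `sorry`, standard axioms).  What is NOT here: the reciprocity value itself (Poitou–Tate
over `ℚ` + Kolyvagin's (7.6)), exactly as in the sibling file; the Čebotarev supply (the engine); the structure-theorem bookkeeping.  BSD is not
proved by any of this; the crux is not proved; the stub is not proved.

References: [McCallumLMS1991] §2 Prop. 2.2, §5 Lemma 5.3; [GrossLMS1991] §3 (3.2)–(3.3), (7.1), Props. 8.1–8.2, 9.6; [SerreAbelianLadic1968]
Ch. I §1.2 (cyclotomic character of a Frobenius); [SilvermanAEC2009] Cor. III.6.4(b).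
-/

set_option autoImplicit false
set_option linter.dupNamespace false -- tree convention: `Summit.BirchSwinnertonDyer.BirchSwinnertonDyer.Theorems` (summit = sub-problem)

noncomputable section

open scoped Classical Pointwise

namespace Summit.BirchSwinnertonDyer.BirchSwinnertonDyer.Theorems.OffBigImageOddLocalAtTwo.Engine

open WeierstrassCurve NumberField IsDedekindDomain Field WithZero
open Literature.NumberTheory.EllipticCurves Literature.NumberTheory.GaloisRepresentations
open Summit.BirchSwinnertonDyer.BirchSwinnertonDyer.Theorems.KolyvaginEigenTwo
open Summit.BirchSwinnertonDyer.BirchSwinnertonDyer.Theorems.GenusExact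
open Summit.BirchSwinnertonDyer.BirchSwinnertonDyer.Theorems.GenusExact.FrobeniusCriterion
open Summit.BirchSwinnertonDyer.BirchSwinnertonDyer.Theorems.GenusKolyTwistingPrime

variable (W : WeierstrassCurve ℚ) [W.IsElliptic]

/-! ## §1 The regular generator of `E[2^M]` over `ℤ/2^M[F]` for ANY `F ∈ Γ_ℚ` moving a `2`-torsion point -/

/-- **`E[2^M] = ℤP ⊕ ℤ·FP` freely over `ℤ/2^M`, for every `F ∈ Gal(ℚ̄/ℚ)` that moves some `v ∈ E[2]`** (REGULAR type; R1 of the line with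
generation AND independence for the SAME `P`): lift the moved `2`-torsion point `v` to `P` with `2^{M−1}P = v` (`E(ℚ̄)` divisible), independence by
`pow_dvd_of_zsmul_add_zsmul_smul_eq_zero`, generation by counting `#E[2^M] = 4^M`.  The sibling's `exists_regular_generator_of_Δ_neg` is the case
`F = c₀`, `Δ < 0` (`exists_twoTorsion_smul_ne_of_Δ_neg`). [cite: SilvermanAEC2009, Cor. III.6.4(b)] [cite: McCallumLMS1991, §5] -/
theorem exists_regular_generator_of_smul_twoTorsion_ne (F : absoluteGaloisGroup ℚ)
    (hmv : ∃ v : geomTorsion W 2, F • v ≠ v) {M : ℕ} (hM : 1 ≤ M) :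
    ∃ P : geomTorsion W ((2 ^ M : ℕ) : ℤ), (2 : ℤ) ^ M • P = 0 ∧
      (∀ Q : geomTorsion W ((2 ^ M : ℕ) : ℤ), ∃ x y : ℤ, Q = x • P + y • F • P) ∧
      (∀ x y : ℤ, x • P + y • F • P = 0 → (2 : ℤ) ^ M ∣ x ∧ (2 : ℤ) ^ M ∣ y) := by
  obtain ⟨v, hv⟩ := hmv
  have hv2 : (2 : ℤ) • (v : geomPoints W) = 0 := (mem_geomTorsion_iff W 2 (v : geomPoints W)).mp v.2
  have hcv : F • (v : geomPoints W) ≠ (v : geomPoints W) := fun h ↦ hv (Subtype.ext h)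
  have hq0 : (((2 ^ (M - 1) : ℕ) : ℤ)) ≠ 0 := by positivity
  obtain ⟨P, hP⟩ := W.zsmul_geomPoints_surjective_of_charZero hq0 (v : geomPoints W)
  have hPv : ((2 ^ (M - 1) : ℕ) : ℤ) • P = (v : geomPoints W) := hP
  have h2M : ((2 ^ M : ℕ) : ℤ) = 2 * ((2 ^ (M - 1) : ℕ) : ℤ) := by
    push_cast
    rw [← pow_succ', Nat.sub_add_cancel hM]
  have hPM : P ∈ geomTorsion W ((2 ^ M : ℕ) : ℤ) := by
    rw [mem_geomTorsion_iff, h2M, mul_smul, hPv, hv2]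
  set P₀ : geomTorsion W ((2 ^ M : ℕ) : ℤ) := ⟨P, hPM⟩ with hP₀
  have hPM' : (2 : ℤ) ^ M • P = 0 := by
    have h := (mem_geomTorsion_iff W _ P).mp hPM
    push_cast at h
    exact h
  have hP₀M : (2 : ℤ) ^ M • P₀ = 0 := Subtype.ext (by
    rw [AddSubgroupClass.coe_zsmul, ZeroMemClass.coe_zero]; exact hPM')
  have hfree : ∀ a b : ℤ, a • P₀ + b • F • P₀ = 0 → (2 : ℤ) ^ M ∣ a ∧ (2 : ℤ) ^ M ∣ b := by
    intro a b hab
    have hab' : a • P + b • (F • P) = 0 := congrArg Subtype.val hab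
    have hPv' : (2 : ℤ) ^ (M - 1) • P = (v : geomPoints W) := by
      have h := hPv
      push_cast at h
      exact h
    exact pow_dvd_of_zsmul_add_zsmul_smul_eq_zero hv2 hcv M P hPM' hPv' a b hab'
  refine ⟨P₀, hP₀M, ?_, hfree⟩
  -- generation by counting: `(a, b) ↦ aP + b·FP` is injective on `(ℤ/2^M)²`, and `#E[2^M] = 4^M`
  haveI : NeZero (2 ^ M) := ⟨pow_ne_zero _ two_ne_zero⟩
  let g : ZMod (2 ^ M) × ZMod (2 ^ M) → geomTorsion W ((2 ^ M : ℕ) : ℤ) := fun ab ↦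
    (ab.1.val : ℤ) • P₀ + (ab.2.val : ℤ) • F • P₀
  have hmod : ∀ {x y : ZMod (2 ^ M)}, ((2 : ℤ) ^ M) ∣ (x.val : ℤ) - y.val → x = y := by
    intro x y hxy
    apply ZMod.val_injective (2 ^ M)
    have hxy' : (((2 ^ M : ℕ) : ℕ) : ℤ) ∣ (x.val : ℤ) - y.val := by push_cast; exact hxy
    exact ((Nat.modEq_iff_dvd.mpr hxy').eq_of_lt_of_lt (ZMod.val_lt y) (ZMod.val_lt x)).symm
  have hinj : Function.Injective g := by
    rintro ⟨a, b⟩ ⟨a', b'⟩ h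
    have h' : ((a.val : ℤ) - a'.val) • P₀ + ((b.val : ℤ) - b'.val) • F • P₀ = 0 := by
      simp only [g] at h
      rw [sub_zsmul, sub_zsmul, ← sub_eq_zero.mpr h]
      abel
    obtain ⟨ha, hb⟩ := hfree _ _ h'
    exact Prod.ext (hmod ha) (hmod hb)
  have hcardT : Nat.card (geomTorsion W ((2 ^ M : ℕ) : ℤ)) = (2 ^ M) ^ 2 :=
    card_torsionPoints_eq_sq_holds W (AlgebraicClosure ℚ) (n := 2 ^ M)
      (by exact_mod_cast pow_ne_zero M two_ne_zero)
  haveI : Finite (geomTorsion W ((2 ^ M : ℕ) : ℤ)) :=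
    Nat.finite_of_card_ne_zero (by rw [hcardT]; positivity)
  have hle : Nat.card (geomTorsion W ((2 ^ M : ℕ) : ℤ)) ≤ Nat.card (ZMod (2 ^ M) × ZMod (2 ^ M)) := by
    rw [hcardT, Nat.card_prod, Nat.card_zmod, sq]
  have hbij : Function.Bijective g := hinj.bijective_of_nat_card_le hle
  intro Q
  obtain ⟨⟨a, b⟩, hab⟩ := hbij.2 Q
  exact ⟨(a.val : ℤ), (b.val : ℤ), hab.symm⟩

/-! ## §2 A Frobenius at a prime `ℓ ≡ −1 (mod q)` inverts `μ_q` -/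

section RootsOfUnity

variable {v : HeightOneSpectrum (𝓞 ℚ)}

/-- The natural generator of the place `v ∋ ℓ` of `ℚ` is `ℓ`. [folklore] -/
theorem natGenerator_eq_of_natCast_mem {ℓ : ℕ} (hℓ : ℓ.Prime) (hℓv : (ℓ : 𝓞 ℚ) ∈ v.asIdeal) :
    Rat.HeightOneSpectrum.natGenerator v = ℓ := by
  have h1 : Rat.HeightOneSpectrum.natGenerator v ∣ ℓ := by
    rw [Rat.HeightOneSpectrum.natGenerator_dvd_iff]
    have := Ideal.mem_map_of_mem (Rat.IsIntegralClosure.intEquiv (𝓞 ℚ)) hℓv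
    rwa [map_natCast] at this
  exact (Nat.prime_dvd_prime_iff_eq (Rat.HeightOneSpectrum.prime_natGenerator v) hℓ).mp h1

/-- **An arithmetic Frobenius at `𝔓 ∣ ℓ` inverts the `q`-th roots of unity when `q ∣ ℓ + 1`** (`ℓ ∤ q`): `F·ζ = ζ^{N(v)} = ζ^ℓ = ζ⁻¹`
(`χ_cyc(Frob_ℓ) = ℓ`).  For a Kolyvagin prime at `2` (`2^M ∣ ℓ + 1`, Gross (3.3) / Zhang's `M(ℓ) ≥ M`) this is the input (μ) of the tame
anti-invariance `smul_h1Eval_eq_neg_of_mem_inertia`, for EVERY Frobenius type (regular or `τ`-type). [cite: SerreAbelianLadic1968, Ch. I §1.2]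
[cite: GrossLMS1991, §3 (3.3)] -/
theorem smul_rootOfUnity_eq_inv_of_isArithFrobAt {ℓ q : ℕ} (hℓ : ℓ.Prime) (hℓv : (ℓ : 𝓞 ℚ) ∈ v.asIdeal)
    (hℓq : ¬ ℓ ∣ q) (hqℓ : q ∣ ℓ + 1) {𝔓 : Ideal (absIntegers (𝓞 ℚ) ℚ)} (h𝔓 : 𝔓 ∈ v.primesAbove)
    {F : absoluteGaloisGroup ℚ} (hF : IsArithFrobAt (𝓞 ℚ) F 𝔓) {ζ : AlgebraicClosure ℚ} (hζ : ζ ^ q = 1) :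
    F • ζ = ζ⁻¹ := by
  have hqv : (q : 𝓞 ℚ) ∉ v.asIdeal := natCast_not_mem_of_not_dvd (v := v) hℓ hℓv hℓq
  have h := smul_eq_pow_residueCard_of_isArithFrobAt_of_pow_eq_one (v := v) hqv h𝔓 hF hζ
  rw [Rat.residueCard_eq_natGenerator, natGenerator_eq_of_natCast_mem hℓ hℓv] at h
  obtain ⟨k, hk⟩ := hqℓ
  have hζ0 : ζ ≠ 0 := by
    rintro rfl
    have hq0 : q ≠ 0 := by rintro rfl; exact hℓq (dvd_zero ℓ)
    rw [zero_pow hq0] at hζ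
    exact zero_ne_one hζ
  have hζℓ1 : ζ ^ (ℓ + 1) = 1 := by rw [hk, pow_mul, hζ, one_pow]
  rw [h]
  apply eq_inv_of_mul_eq_one_left
  rw [← pow_succ, hζℓ1]

end RootsOfUnity

/-! ## §3 The regular-Frobenius datum moves between the primes above `ℓ` -/

section Transfer

variable {v : HeightOneSpectrum (𝓞 ℚ)}

omit [W.IsElliptic] in
/-- **Regular Frobenius at one prime above `ℓ` ⟹ at every prime above `ℓ`.**  If some arithmetic Frobenius `h` at some `𝔓₀ ∣ ℓ` acts on
`E[q]` as an involution moving a point of `E[2]` (the shape the line's engine outputs, `∃ v 𝔓 h, …`), then at EVERY `𝔓 ∣ ℓ` there is an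
arithmetic Frobenius with the same two properties: conjugate by `γ ∈ Γ_ℚ` with `γ𝔓₀ = 𝔓` (the tree's
`exists_isArithFrobAt_conj_of_mem_primesAbove_holds`); `γhγ⁻¹` is again an involution on `E[q]` and moves `γ·v`. [cite: GrossLMS1991, §3 (3.2)] -/
theorem regularFrobAt_transfer {q : ℕ} {𝔓₀ : Ideal (absIntegers (𝓞 ℚ) ℚ)} (h𝔓₀ : 𝔓₀ ∈ v.primesAbove)
    {h : absoluteGaloisGroup ℚ} (hh : IsArithFrobAt (𝓞 ℚ) h 𝔓₀)
    (hinv : ∀ X : geomTorsion W (q : ℤ), h • h • X = X) (hmv : ∃ u : geomTorsion W 2, h • u ≠ u)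
    {𝔓 : Ideal (absIntegers (𝓞 ℚ) ℚ)} (h𝔓 : 𝔓 ∈ v.primesAbove) :
    ∃ F : absoluteGaloisGroup ℚ, IsArithFrobAt (𝓞 ℚ) F 𝔓 ∧ (∀ X : geomTorsion W (q : ℤ), F • F • X = X) ∧
      ∃ u : geomTorsion W 2, F • u ≠ u := by
  obtain ⟨γ, -, hFrob'⟩ := HeightOneSpectrum.exists_isArithFrobAt_conj_of_mem_primesAbove_holds h𝔓₀ h𝔓 hh
  obtain ⟨u, hu⟩ := hmv
  refine ⟨γ * h * γ⁻¹, hFrob', fun X ↦ ?_, ⟨γ • u, fun hγu ↦ hu ?_⟩⟩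
  · rw [mul_smul, mul_smul, mul_smul, mul_smul, inv_smul_smul, hinv, smul_inv_smul]
  · rw [mul_smul, mul_smul, inv_smul_smul] at hγu
    exact smul_left_cancel γ hγu

end Transfer

/-! ## §4 McCallum's Lemma 5.3 with Prop. 2.2 over `ℚ_ℓ` at `2` at a REGULAR Kolyvagin prime -/

section Main

variable {v : HeightOneSpectrum (𝓞 ℚ)}

/-- **McCallum 1991, Lemma 5.3 with Prop. 2.2, over `ℚ_ℓ` at `p = 2`, at a REGULAR Kolyvagin prime — no sign condition on `Δ(E)`.**
Let `E = W/ℚ` be elliptic, `q = 2^M` (`M ≥ 1`), `ℓ` an odd prime at the place `v` of good reduction with `q ∣ ℓ + 1`, such that an arithmetic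
Frobenius at some prime `𝔓₀ ∣ ℓ` of `\bar ℤ` acts on `E[q]` as an INVOLUTION MOVING A `2`-TORSION POINT (a regular Kolyvagin prime of the line's
engine; on `Δ < 0` every Gross–Kolyvagin prime `Frob(ℓ) = Frob(∞)` is such).  Let `e` be a biadditive alternating left-non-degenerate pairing on
`E[q]`; `d ∈ H¹(ℚ, E[q])` with `2^a d` NOT Selmer at `v`; `s ∈ H¹(ℚ, E[q])` Selmer at `v`.  ASSUME the reciprocity value vanishes:
`e([s, F], [d, σ]) = 0` for every arithmetic Frobenius `F` at every `𝔓 ∣ v` acting on `E[q]` as an involution and every `σ ∈ I_𝔓` (McCallum's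
Prop. 2.2 made explicit at `ℓ`).  **Then `2^{M−1−a}·s_v = 0` in `H¹(ℚ_ℓ, E[q])`** — the printed exponent, NO defect at `2`: over `ℚ_ℓ`,
`E(ℚ_ℓ)/q` and `H¹(ℚ_ℓ, E)_q` are the coinvariant and conorm lines of the regular `ℤ/q[F]`-module `E[q]`, both cyclic of order `q`.
Proof = the sibling's `lemma_5_3_descent_of_reciprocity_rat_two` with its two `Δ < 0` inputs replaced: the regular generator from §1 (moved
`2`-torsion point as hypothesis, transported to the prime of the chosen embedding by §3) and `F` inverting `μ_q` from `q ∣ ℓ + 1` (§2).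
[cite: McCallumLMS1991, §5 Lemma 5.3 (with §2 Prop. 2.2)] [cite: GrossLMS1991, §3 (3.3), (7.1), Prop. 9.6] -/
theorem lemma_5_3_descent_of_reciprocity_rat_two_regular {M : ℕ} (hM : 1 ≤ M) {q : ℕ}
    (hq : q = 2 ^ M) {ℓ : ℕ} (hℓ : ℓ.Prime) (hℓ2 : ℓ ≠ 2) (hℓv : (ℓ : 𝓞 ℚ) ∈ v.asIdeal) (hqℓ : q ∣ ℓ + 1)
    (hgood : W.HasGoodReductionAt v)
    (hreg : ∃ (𝔓₀ : Ideal (absIntegers (𝓞 ℚ) ℚ)) (h : absoluteGaloisGroup ℚ), 𝔓₀ ∈ v.primesAbove ∧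
      IsArithFrobAt (𝓞 ℚ) h 𝔓₀ ∧ (∀ X : geomTorsion W (q : ℤ), h • h • X = X) ∧ ∃ u : geomTorsion W 2, h • u ≠ u)
    {C : Type*} [AddCommGroup C] (e : geomTorsion W (q : ℤ) →+ geomTorsion W (q : ℤ) →+ C)
    (halt : ∀ x, e x x = 0) (hnd : ∀ x, (∀ y, e x y = 0) → x = 0)
    {d : galH1Torsion W (q : ℤ)} {a : ℕ}
    (hdv : ((2 : ℤ) ^ a) • d ∉ selmerLocalKer W (v.adicCompletion ℚ) (q : ℤ))
    {s : galH1Torsion W (q : ℤ)} (hs : s ∈ selmerLocalKer W (v.adicCompletion ℚ) (q : ℤ))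
    (hR : ∀ 𝔓 ∈ v.primesAbove, ∀ F : absoluteGaloisGroup ℚ, IsArithFrobAt (𝓞 ℚ) F 𝔓 →
      (∀ X : geomTorsion W (q : ℤ), F • F • X = X) →
      ∀ σ ∈ 𝔓.inertia (absoluteGaloisGroup ℚ),
        e (h1Eval W (q : ℤ) s F) (h1Eval W (q : ℤ) d σ) = 0) :
    ((2 : ℤ) ^ (M - 1 - a)) • s ∈ W.torsionLocalKer (v.adicCompletion ℚ) (q : ℤ) := by
  subst hq
  -- ### Step 0: `2, q ∉ v`, `v` good
  have h2v : ((2 : ℕ) : 𝓞 ℚ) ∉ v.asIdeal := two_notMem_of_odd_prime_mem hℓ hℓ2 hℓv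
  have hqv' : ((2 ^ M : ℕ) : 𝓞 ℚ) ∉ v.asIdeal := by
    rw [Nat.cast_pow]
    exact fun h ↦ h2v (v.isPrime.mem_of_pow_mem M h)
  have hqv : ((((2 ^ M : ℕ) : ℤ)) : 𝓞 ℚ) ∉ v.asIdeal := by rwa [Int.cast_natCast]
  have hq0 : (2 ^ M : ℕ) ≠ 0 := pow_ne_zero M two_ne_zero
  have hq0Z : ((2 ^ M : ℕ) : ℤ) ≠ 0 := by exact_mod_cast hq0
  have hℓq : ¬ ℓ ∣ 2 ^ M := fun h ↦ hℓ2 ((Nat.prime_dvd_prime_iff_eq hℓ Nat.prime_two).mp (hℓ.dvd_of_dvd_pow h))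
  have hwbad : v ∉ W.badPlaces (𝓞 ℚ) := fun h ↦ h hgood
  -- ### Step 1: the prime `𝔓` of the chosen embedding, a REGULAR Frobenius `F` there (transfer from `𝔓₀`)
  obtain ⟨𝔐, h𝔐⟩ := v.localPrimesAbove_nonempty
  set 𝔓 := v.primeBelow (closureEmb (K := ℚ) (v.adicCompletion ℚ)) 𝔐 with h𝔓def
  have h𝔓 : 𝔓 ∈ v.primesAbove := HeightOneSpectrum.primeBelow_mem_primesAbove h𝔐
  haveI : 𝔓.IsPrime := h𝔓.1
  obtain ⟨𝔓₀, h, h𝔓₀, hh, hhinv, hhmv⟩ := hreg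
  obtain ⟨F, hFrob, hF, hFmv⟩ := regularFrobAt_transfer W h𝔓₀ hh hhinv hhmv h𝔓
  -- ### Step 2: `E[q]` is a regular `ℤ/q[F]`-module
  obtain ⟨P, hPM, hgenF, hfreeF⟩ := exists_regular_generator_of_smul_twoTorsion_ne W F hFmv hM
  -- ### Step 3: the inputs of the local criterion
  have hI : 𝔓.inertia (absoluteGaloisGroup ℚ) ≤ torsionFixing W ((2 ^ M : ℕ) : ℤ) :=
    inertia_le_torsionFixing W hwbad hqv _ h𝔐
  have hopen := isOpen_torsionFixing W hq0Z
  haveI : CharZero (v.adicCompletion ℚ) :=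
    charZero_of_injective_algebraMap (algebraMap ℚ (v.adicCompletion ℚ)).injective
  -- the `ℚ`-algebra structure on `ℚ_v` is the canonical `instAlgebraAdicCompletion` (fed by unification)
  have hsurj : Function.Surjective (@torsionPointsMap ℚ _ W (v.adicCompletion ℚ) _
      (HeightOneSpectrum.instAlgebraAdicCompletion (𝓞 ℚ) ℚ v) ((2 ^ M : ℕ) : ℤ)) :=
    (@torsionPointsMap_bijective ℚ _ _ W _ (v.adicCompletion ℚ) _
      (HeightOneSpectrum.instAlgebraAdicCompletion (𝓞 ℚ) ℚ v) _ (2 ^ M) hq0).2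
  have hx : s ∈ unramifiedKer (geomTorsion W ((2 ^ M : ℕ) : ℤ)) 𝔓 :=
    selmerLocalKer_le_unramifiedKer (HeightOneSpectrum.exists_mem_inertia_apply_eq_holds v)
      W.smul_localPoints_eq_of_mem_inertia_holds hwbad hqv h𝔓 hs
  -- ### Step 4: the tame side — a tame value of `d` of order `> 2^a`, anti-invariant under `F`
  have hd0 : ∃ σ₀ ∈ 𝔓.inertia (absoluteGaloisGroup ℚ),
      ((2 : ℤ) ^ a) • h1Eval W ((2 ^ M : ℕ) : ℤ) d σ₀ ≠ 0 := by
    by_contra hall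
    push Not at hall
    apply hdv
    rw [← oneCocycleClass_reprCocycle W ((2 ^ M : ℕ) : ℤ) (((2 : ℤ) ^ a) • d)]
    refine (W.oneCocycleClass_mem_selmerLocalKer_iff hgood hqv h𝔓
      (reprCocycle W ((2 ^ M : ℕ) : ℤ) (((2 : ℤ) ^ a) • d))).mpr fun τ hτ ↦ ?_
    have h1 := hall τ hτ
    change h1Eval W ((2 ^ M : ℕ) : ℤ) (((2 : ℤ) ^ a) • d) τ = 0
    rwa [h1Eval_zsmul _ _ _ _ (hI hτ)]
  -- cyclicity of the tame image: a generator `σ₁`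
  have hcard : Nat.card (geomTorsion W ((2 ^ M : ℕ) : ℤ)) = (2 ^ M) ^ 2 :=
    card_torsionPoints_eq_sq_holds W (AlgebraicClosure ℚ) (n := 2 ^ M) (by exact_mod_cast hq0)
  haveI : Finite (geomTorsion W ((2 ^ M : ℕ) : ℤ)) :=
    Nat.finite_of_card_ne_zero (by rw [hcard]; positivity)
  have hTq : ∀ Q : geomTorsion W ((2 ^ M : ℕ) : ℤ), (2 ^ M) • Q = 0 := fun Q ↦ by
    have := (mem_geomTorsion_iff W ((2 ^ M : ℕ) : ℤ) _).mp Q.2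
    apply Subtype.ext
    rw [AddSubgroupClass.coe_nsmul, ← natCast_zsmul]
    exact_mod_cast this
  set av : 𝔓.inertia (absoluteGaloisGroup ℚ) → geomTorsion W ((2 ^ M : ℕ) : ℤ) :=
    fun τ ↦ h1Eval W ((2 ^ M : ℕ) : ℤ) d τ with hav
  have hac : Continuous av := (continuous_h1Eval _ _ d).comp continuous_subtype_val
  have haa : ∀ τ τ', av (τ * τ') = av τ + av τ' := fun τ τ' ↦
    h1Eval_mul W ((2 ^ M : ℕ) : ℤ) d (hI τ.2) τ'
  have hπ : v.valuation ℚ (Rat.HeightOneSpectrum.natGenerator v : ℚ) = exp (-1 : ℤ) :=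
    Rat.valuation_natGenerator v
  obtain ⟨z, hz⟩ := IsAlgClosed.exists_pow_nat_eq
    (algebraMap ℚ (AlgebraicClosure ℚ) (Rat.HeightOneSpectrum.natGenerator v : ℚ)) (Nat.pos_of_ne_zero hq0)
  obtain ⟨σ₁, -, hgenσ⟩ :=
    InertiaTame.exists_forall_apply_eq_nsmul v (Nat.pos_of_ne_zero hq0) hqv' hπ hz h𝔓 hTq av hac haa
  have hy₀a : ((2 : ℤ) ^ a) • av σ₁ ≠ 0 := by
    obtain ⟨σ₀, hσ₀, hσ₀a⟩ := hd0
    intro h0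
    apply hσ₀a
    obtain ⟨k, hk⟩ := hgenσ ⟨σ₀, hσ₀⟩
    change ((2 : ℤ) ^ a) • av ⟨σ₀, hσ₀⟩ = 0
    rw [hk, smul_comm, h0, smul_zero]
  -- `F` inverts `μ_q` (`q ∣ ℓ + 1`, §2) and stabilises `𝔓`, so `F·[d, σ₁] = −[d, σ₁]`
  have hFμ : ∀ ζ : AlgebraicClosure ℚ, ζ ^ (2 ^ M) = 1 → F • ζ = ζ⁻¹ := fun ζ hζ ↦
    smul_rootOfUnity_eq_inv_of_isArithFrobAt hℓ hℓv hℓq hqℓ h𝔓 hFrob hζ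
  have hF𝔓 : F • 𝔓 = 𝔓 := MulAction.mem_stabilizer_iff.mp hFrob.mem_stabilizer
  have ht : F • av σ₁ = -av σ₁ :=
    smul_h1Eval_eq_neg_of_mem_inertia W Nat.prime_two rfl hqv' h𝔓 hF𝔓 hFμ hI d σ₁.2
  -- ### Step 5: the reciprocity value and the no-defect Lemma 5.3 over `ℚ_ℓ`
  have het : e (h1Eval W ((2 ^ M : ℕ) : ℤ) s F) (av σ₁) = 0 := hR 𝔓 h𝔓 F hFrob hF σ₁ σ₁.2
  exact pow_zsmul_mem_torsionLocalKer_of_pairing_eq_zero W h𝔐 hFrob hI hopen hsurj hF hM hPM hgenF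
    hfreeF e halt hnd hx ht hy₀a het

/-- **The sibling's `Δ < 0` theorem is the `τ`-type instance.**  On `Δ < 0` a Gross–Kolyvagin prime (`FrobEqFrobInfty W K q ℓ`: some
Frobenius at some `𝔓 ∣ ℓ` acts on `E[q]` as a complex conjugation `c₀`) is a regular Kolyvagin prime in the sense of the main theorem when
`2 ∣ q`: `c₀² = 1`, and `c₀` moves a `2`-torsion point (`exists_twoTorsion_smul_ne_of_Δ_neg`), which lies in `E[q]`.  (Why the regular form is the
right generalisation for `Δ > 0`, where `c₀` FIXES `E[2]`: the line's R1/LKL.) [cite: McCallumLMS1991, §5 Lemma 5.3] [cite: GrossLMS1991, §3 (3.2)] -/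
theorem regularFrob_of_frobEqFrobInfty_of_Δ_neg (hΔ : W.Δ < 0) {q ℓ : ℕ} (h2q : (2 : ℤ) ∣ (q : ℤ)) (hℓ : ℓ.Prime)
    {K : Type} [Field K] [NumberField K] (hℓM : FrobEqFrobInfty W K q ℓ) (hℓv : (ℓ : 𝓞 ℚ) ∈ v.asIdeal) :
    ∃ (𝔓₀ : Ideal (absIntegers (𝓞 ℚ) ℚ)) (h : absoluteGaloisGroup ℚ), 𝔓₀ ∈ v.primesAbove ∧
      IsArithFrobAt (𝓞 ℚ) h 𝔓₀ ∧ (∀ X : geomTorsion W (q : ℤ), h • h • X = X) ∧ ∃ u : geomTorsion W 2, h • u ≠ u := by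
  obtain ⟨v₀, 𝔓₀, h, c₀, hℓv₀, h𝔓₀, hFrob, hc₀, hhP, -⟩ := hℓM
  have hv : v₀ = v := HeightOneSpectrum.eq_of_natCast_mem_rat hℓ hℓv₀ hℓv
  subst hv
  obtain ⟨u, hu⟩ := exists_twoTorsion_smul_ne_of_Δ_neg W hΔ hc₀
  refine ⟨𝔓₀, h, h𝔓₀, hFrob, fun X ↦ ?_, ⟨u, fun hhu ↦ hu ?_⟩⟩
  · rw [hhP, hhP, ← mul_smul, ← pow_two, hc₀.sq_eq_one, one_smul]
  · -- the moved `2`-torsion point lies in `E[q]` (`2 ∣ q`), where `h = c₀`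
    have hu2 : (2 : ℤ) • (u : geomPoints W) = 0 := (mem_geomTorsion_iff W 2 (u : geomPoints W)).mp u.2
    have huq : (u : geomPoints W) ∈ geomTorsion W (q : ℤ) := by
      obtain ⟨k, hk⟩ := h2q
      rw [mem_geomTorsion_iff, hk, mul_comm, mul_smul, hu2, smul_zero]
    have hU := congrArg Subtype.val (hhP ⟨u, huq⟩)
    have hhu' := congrArg Subtype.val hhu
    apply Subtype.ext
    -- `hU : h • u = c₀ • u` and `hhu' : h • u = u` in `E(ℚ̄)`
    change (h • (⟨u, huq⟩ : geomTorsion W (q : ℤ))).1 = (c₀ • (⟨u, huq⟩ : geomTorsion W (q : ℤ))).1 at hU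
    change (h • u : geomTorsion W 2).1 = u.1 at hhu'
    have e1 : (c₀ • u : geomTorsion W 2).1 = c₀ • (u : geomPoints W) := rfl
    have e2 : (h • u : geomTorsion W 2).1 = h • (u : geomPoints W) := rfl
    have e3 : (h • (⟨u, huq⟩ : geomTorsion W (q : ℤ))).1 = h • (u : geomPoints W) := rfl
    have e4 : (c₀ • (⟨u, huq⟩ : geomTorsion W (q : ℤ))).1 = c₀ • (u : geomPoints W) := rfl
    rw [e1, ← e4, ← hU, e3, ← e2, hhu']

end Main

end Summit.BirchSwinnertonDyer.BirchSwinnertonDyer.Theorems.OffBigImageOddLocalAtTwo.Engine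

end
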